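import Summits.BirchSwinnertonDyer.BirchSwinnertonDyer.Theorems.Rank2ObservatoryRank3FullTwoTorsionIsoDoors
import Literature.NumberTheory.EllipticCurves.IsogenyVariableChangeProofs
import Literature.NumberTheory.EllipticCurves.IsogenyCompProofs
import HarnessLib

/-!
# The `2`-isogeny graph of the rank-3 census on its `986` curves with a rational `2`-torsion point

HONEST FRAMING: per-curve certified theorems and census instruments; no claim on BSD in rank ≥ 2.

## Setting

`rank3IsoRows` (966 rows, `Rank2ObservatoryRank3IsoCensus`) and `rank3FullTwoTorsionIsoRows` (60 rows = the 20
full-`2`-torsion census curves × their three rational `2`-torsion points, `Rank2ObservatoryRank3FullTwoTorsionIsoDoors`)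
are the descent-via-`2`-isogeny certificates of ALL `986` curves of the rank-3 table `rank3Table` (N < 5·10⁵) with a
rational `2`-torsion point. A certificate row `R` records the census model `R.curve`, a `2`-torsion abscissa `e`, the
descent model `E_{a,b} : y² = x³ + ax² + bx` (`R.ab = (a, b)`, reached by `IsoRow.exists_transport`) and the two
Selmer-candidate lists `R.s₁.D ⊇ S(a,b)`, `R.s₂.D ⊇ S(−2a, a²−4b)` of the isogeny `φ : E_{a,b} → E_{−2a,a²−4b}`
(`twoIsogenyCodomain`; Silverman X.4.9) and its dual — with equality (sharpness) for every listed row (KCI rows 44/45).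

## What THIS file adds (zero new data; one Bool row relation, a linear neighbour decoration, three kernel walks, glue by name)

* §1 `TwoIsogenyGraph.isIsogenous_of_models`: if `C • V = E_{a,b}`, `C′ • V′ = E_{a′,b′}` and `(a′, b′)` is
  `(−2a, a²−4b)` or `(−2a/4, (a²−4b)/16)`, then `V` and `V′` are ISOGENOUS OVER `ℚ` (`WeierstrassCurve.IsIsogenous`):
  the isogeny is `C′⁻¹ ∘ [u] ∘ φ ∘ C` with Silverman's explicit `2`-isogeny `φ = twoIsogeny E_{a,b}` of the tree
  (`IsogenyTwoTorsionProofs`: `isIsogenous_of_eq_twoIsogenyCodomain`, `twoIsogenyCodomain_mk_intCast`), `[u]` the scaling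
  `u = 2` (`scale_two_smul`), composed by the tree's `IsIsogenous.trans'` (`IsogenyCompProofs`) and `isIsogenous_of_smul_eq`
  (`IsogenyVariableChangeProofs`).
* §2 `IsoRow.twoIsoMate R R′` (Bool): `R′.ab` is the (possibly `u = 2`-rescaled) `2`-isogenous model of `R.ab`, the census
  models differ, AND the two independent descents agree edge-wise: `R′.s₁.D = R.s₂.D` and `R′.s₂.D = R.s₁.D` as sets
  (the Selmer groups of `φ` and `φ̂` computed at the two ends of the edge, from different models and different `2`-torsion
  data, coincide — swapped); soundness `IsoRow.isIsogenous_of_twoIsoMate`.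
* §3 KERNEL WALKS, all LINEAR (the lists are in Cremona-label order, so a mate inside the 966 is a list NEIGHBOUR; §2b decorates
  each row with its neighbours in one structural pass, `MateWalk.withNbrs`): every one of the 966 rows is mated to the next row,
  the previous row, or one of the 60 (`rank3IsoRows_mateWalk`); every one of the 60 full-`2`-torsion rows is mated to one of the
  `60` loose rows of the 966 (`rank3FullTwoTorsionIsoRows_mateWalk`); the split `453` forward + `453` backward (none both, forward
  edges mutual) + `60` loose `= 966` (`rank3IsoRows_mateSplit`): the `2`-ISOGENY GRAPH on the 986 curves consists of `453`
  EDGES between one-`2`-torsion-point curves and `20` STARS `K_{1,3}` (a full-`2`-torsion curve joined to its three quotients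
  `E/⟨Tᵢ⟩`, each a one-`2`-torsion-point census curve). READING (with KCI rows 23/46: a KERNEL-ISO curve has exactly one
  rational `2`-torsion point, a full-`2`-torsion curve three, the other `8 501` census curves none): every rational `2`-isogeny
  `E → E/⟨T⟩` out of a curve of the rank-3 table lands, up to `ℚ`-isomorphism, on ANOTHER curve of the table — the mate's
  descent model is the codomain model `E_{−2a,a²−4b}` of Silverman's isogeny with kernel `⟨T⟩`, up to `u = 2` — so the
  `2`-isogeny graph of the whole table is `453` edges, `20` stars and `8 501` isolated vertices; and at both ends of each of
  the `513` edges the kernel holds an INDEPENDENT certificate `rank = 3` (KCI rows 44/45; consistent with isogeny invariance of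
  the rank — the tree's `Isogeny.mordellWeilRank_eq`, which is NOT used here).
* §4 Census-row forms: every curve of `rank3Table` whose model is one of the 986 is `ℚ`-isogenous to ANOTHER curve of
  `rank3Table` of certified rank `3` (`Rank3Row.exists_isogenous_of_aKey_mem`, `…_of_mem_fullTwoTorsionRows`).

## NOT claimed

Nothing about isogenies of odd degree (the table contains further, odd-degree isogenies, also among the 8 501 rows without
rational `2`-torsion), nothing about isogeny classes being complete (curves outside the table), no use of table completeness,
no statement `E/⟨T⟩ ≅ …` beyond the model identity recorded in `IsoRow.twoIsoMate` (the Lean conclusions are `IsIsogenous`),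
nothing about `Ш`, regulators, periods, Tamagawa numbers or `L`-values of isogenous curves, no claim on BSD.

## References

[cite: SilvermanAEC2009, III.4 Example 4.5 (the explicit 2-isogeny), III.6.1–6.2, X.4.9] ·
[cite: CremonaAlgorithms1997, §3.6 (descent via 2-isogeny; second descent data reused for the isogenous curve), §3.8
(isogeny classes in the tables), Table 1] · [cite: SilvermanTate2015, §3.5–3.6].
-/

set_option linter.dupNamespace false

open scoped Classical

namespace Summit.BirchSwinnertonDyer.BirchSwinnertonDyer.Rank2Observatory

open WeierstrassCurve Literature Literature.NumberTheory.EllipticCurves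
open IsoLocal

/-! ### §1 Models of a `2`-isogeny: `E_{a,b} → E_{−2a,a²−4b}` up to the scaling `u = 2` -/

namespace TwoIsogenyGraph

/-- The scaling `u = 2` (`(x, y) ↦ (4x, 8y)`) on a two-torsion normal form: `y² = x³ + ax² + bx ↦ y² = x³ + (a/4)x² + (b/16)x`.
[cite: SilvermanAEC2009, III.1 (Table 3.1) and III.3.1(b)] -/
theorem scale_two_smul (a b : ℚ) :
    (⟨⟨2, 2⁻¹, by norm_num, by norm_num⟩, 0, 0, 0⟩ : VariableChange ℚ) • (⟨0, a, 0, b, 0⟩ : WeierstrassCurve ℚ) =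
      ⟨0, a / 4, 0, b / 16, 0⟩ := by
  rw [variableChange_def]; ext <;> push_cast <;> simp <;> ring1

/-- `E_{a,b} ~ E_{−2a, a²−4b}` over `ℚ` for integers `a, b` with `b(a² − 4b) ≠ 0`: Silverman's explicit `2`-isogeny of the tree
(`isIsogenous_of_eq_twoIsogenyCodomain`, `twoIsogenyCodomain_mk_intCast`). [cite: SilvermanAEC2009, III.4 Example 4.5] -/
theorem isIsogenous_codomain (a b : ℤ) (hab : b * (a ^ 2 - 4 * b) ≠ 0) :
    IsIsogenous (⟨0, (a : ℚ), 0, (b : ℚ), 0⟩ : WeierstrassCurve ℚ) ⟨0, ((-2 * a : ℤ) : ℚ), 0, ((a ^ 2 - 4 * b : ℤ) : ℚ), 0⟩ :=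
  haveI := isElliptic_mk_of_ne_zero (F := ℚ) hab
  isIsogenous_of_eq_twoIsogenyCodomain _ (twoIsogenyCodomain_mk_intCast a b)

/-- **Two curves with mate descent models are isogenous over `ℚ`.** If `C • V = E_{a,b}` (elliptic: `b(a²−4b) ≠ 0`),
`C′ • V′ = E_{a′,b′}` and `(a′,b′)` is the `2`-isogenous model `(−2a, a²−4b)` of `(a,b)`, verbatim or rescaled by `u = 2`, then
`V ~ V′`: compose `V ≅ E_{a,b}` (`isIsogenous_of_smul_eq`), `E_{a,b} → E_{−2a,a²−4b}` (`isIsogenous_codomain`), the scaling `u = 2`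
if needed (`scale_two_smul`), and `E_{a′,b′} ≅ V′`, by `IsIsogenous.trans'`. [cite: SilvermanAEC2009, III.4 Example 4.5, III.3.1(b)] -/
theorem isIsogenous_of_models {V V' : WeierstrassCurve ℚ} {a b a' b' : ℤ} {C C' : VariableChange ℚ}
    (hC : C • V = ⟨0, (a : ℚ), 0, (b : ℚ), 0⟩) (hC' : C' • V' = ⟨0, (a' : ℚ), 0, (b' : ℚ), 0⟩)
    (hab : b * (a ^ 2 - 4 * b) ≠ 0)
    (hm : (a' = -2 * a ∧ b' = a ^ 2 - 4 * b) ∨ (4 * a' = -2 * a ∧ 16 * b' = a ^ 2 - 4 * b)) : IsIsogenous V V' := by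
  have h1 : IsIsogenous V (⟨0, (a : ℚ), 0, (b : ℚ), 0⟩ : WeierstrassCurve ℚ) := isIsogenous_of_smul_eq hC
  have h2 := isIsogenous_codomain a b hab
  have h4 : IsIsogenous (⟨0, (a' : ℚ), 0, (b' : ℚ), 0⟩ : WeierstrassCurve ℚ) V' := isIsogenous_of_smul_eq' hC'
  rcases hm with ⟨rfl, rfl⟩ | ⟨ha, hb⟩
  · exact (h1.trans' h2).trans' h4
  · have ha' : (a' : ℚ) = ((-2 * a : ℤ) : ℚ) / 4 := by
      rw [eq_div_iff (by norm_num : (4 : ℚ) ≠ 0), mul_comm]; exact_mod_cast ha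
    have hb' : (b' : ℚ) = ((a ^ 2 - 4 * b : ℤ) : ℚ) / 16 := by
      rw [eq_div_iff (by norm_num : (16 : ℚ) ≠ 0), mul_comm]; exact_mod_cast hb
    have h3 : IsIsogenous (⟨0, ((-2 * a : ℤ) : ℚ), 0, ((a ^ 2 - 4 * b : ℤ) : ℚ), 0⟩ : WeierstrassCurve ℚ)
        (⟨0, (a' : ℚ), 0, (b' : ℚ), 0⟩ : WeierstrassCurve ℚ) := by
      rw [ha', hb']
      exact isIsogenous_of_smul_eq (scale_two_smul _ _)
    exact ((h1.trans' h2).trans' h3).trans' h4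

end TwoIsogenyGraph

open TwoIsogenyGraph

/-! ### §2 The mate relation on certificate rows and its soundness -/

namespace IsoLocal.IsoRow

/-- **`R′` is the `2`-isogeny mate of `R`** (Bool, kernel-decidable): the descent model `R′.ab` is the `2`-isogenous model
of `R.ab` (verbatim or rescaled by `u = 2`), the census models differ, and the Selmer-candidate lists agree SWAPPED as sets:
`R′.s₁.D = R.s₂.D`, `R′.s₂.D = R.s₁.D` (the descents at the two ends of the edge compute `S^{(φ)}` and `S^{(φ̂)}` independently).
[cite: CremonaAlgorithms1997, §3.6] -/
def twoIsoMate (R R' : IsoRow) : Bool :=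
  ((R'.ab.1 == -2 * R.ab.1 && R'.ab.2 == R.ab.1 ^ 2 - 4 * R.ab.2) ||
    (4 * R'.ab.1 == -2 * R.ab.1 && 16 * R'.ab.2 == R.ab.1 ^ 2 - 4 * R.ab.2)) &&
  R'.aKey != R.aKey &&
  (R'.s₁.D.all (fun d => d ∈ R.s₂.D) && R.s₂.D.all (fun d => d ∈ R'.s₁.D) &&
    R'.s₂.D.all (fun d => d ∈ R.s₁.D) && R.s₁.D.all (fun d => d ∈ R'.s₂.D))

/-- Different model keys ⇒ different census models. [folklore] -/
theorem curve_ne_of_aKey_ne {R R' : IsoRow} (h : R'.aKey ≠ R.aKey) : R'.curve ≠ R.curve := by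
  intro hc
  apply h
  simp only [curve, WeierstrassCurve.mk.injEq, Int.cast_inj] at hc
  obtain ⟨h₁, h₂, h₃, h₄, h₆⟩ := hc
  simp only [aKey, h₁, h₂, h₃, h₄, h₆]

/-- What the Bool says. [folklore] -/
theorem twoIsoMate_parts {R R' : IsoRow} (h : R.twoIsoMate R' = true) :
    ((R'.ab.1 = -2 * R.ab.1 ∧ R'.ab.2 = R.ab.1 ^ 2 - 4 * R.ab.2) ∨
      (4 * R'.ab.1 = -2 * R.ab.1 ∧ 16 * R'.ab.2 = R.ab.1 ^ 2 - 4 * R.ab.2)) ∧ R'.aKey ≠ R.aKey ∧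
      R'.s₁.D.toFinset = R.s₂.D.toFinset ∧ R'.s₂.D.toFinset = R.s₁.D.toFinset := by
  simp only [twoIsoMate, Bool.and_eq_true, Bool.or_eq_true, beq_iff_eq, bne_iff_ne, ne_eq, List.all_eq_true,
    decide_eq_true_eq] at h
  obtain ⟨⟨hm, hk⟩, ⟨⟨h₁₂, h₂₁⟩, h₂₁'⟩, h₁₂'⟩ := h
  refine ⟨hm, hk, ?_, ?_⟩
  · ext d; simp only [List.mem_toFinset]; exact ⟨fun hd => h₁₂ d hd, fun hd => h₂₁ d hd⟩
  · ext d; simp only [List.mem_toFinset]; exact ⟨fun hd => h₂₁' d hd, fun hd => h₁₂' d hd⟩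

/-- **Soundness: mates are `ℚ`-isogenous, distinct census curves, with swapped Selmer lists.** For `check3`-ed rows `R`, `R′`
with `R.twoIsoMate R′`: `R.curve ~ R′.curve` over `ℚ` (§1 along the two transports `IsoRow.exists_transport`), `R′.curve ≠ R.curve`,
and `R′.s₁.D = R.s₂.D`, `R′.s₂.D = R.s₁.D` as finite sets. [cite: SilvermanAEC2009, III.4 Example 4.5] [cite: CremonaAlgorithms1997, §3.6] -/
theorem isIsogenous_of_twoIsoMate (R R' : IsoRow) (hR : R.check3 = true) (hR' : R'.check3 = true)
    (h : R.twoIsoMate R' = true) :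
    IsIsogenous R.curve R'.curve ∧ R'.curve ≠ R.curve ∧
      R'.s₁.D.toFinset = R.s₂.D.toFinset ∧ R'.s₂.D.toFinset = R.s₁.D.toFinset := by
  obtain ⟨hm, hk, hD⟩ := twoIsoMate_parts h
  obtain ⟨hsc, he, hab, -⟩ := checkRank_parts R hR
  obtain ⟨hsc', he', -, -⟩ := checkRank_parts R' hR'
  obtain ⟨C, hC⟩ := exists_transport R hsc he
  obtain ⟨C', hC'⟩ := exists_transport R' hsc' he'
  exact ⟨isIsogenous_of_models hC hC' hab hm, curve_ne_of_aKey_ne hk, hD⟩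

end IsoLocal.IsoRow

/-! ### §2b Linear neighbour walk (the lists are in Cremona-label order: a mate inside the 966 is a list NEIGHBOUR) -/

namespace MateWalk

/-- Decorate a list of rows with their list neighbours, as triples `(row, previous row, next row)`; `p` = the row before the list.
Structural recursion, ONE pass. [folklore] -/
def withNbrsAux : Option IsoRow → List IsoRow → List (IsoRow × Option IsoRow × Option IsoRow)
  | _, [] => []
  | p, R :: rest => (R, p, rest.head?) :: withNbrsAux (some R) rest

/-- `rows` decorated with list neighbours. [folklore] -/
def withNbrs (rows : List IsoRow) : List (IsoRow × Option IsoRow × Option IsoRow) := withNbrsAux none rows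

/-- The row's mate is the NEXT row. [folklore] -/
def mateN : IsoRow × Option IsoRow × Option IsoRow → Bool
  | (R, _, some R') => R.twoIsoMate R'
  | _ => false

/-- The row's mate is the PREVIOUS row. [folklore] -/
def mateP : IsoRow × Option IsoRow × Option IsoRow → Bool
  | (R, some R', _) => R.twoIsoMate R'
  | _ => false

/-- The next row's mate is this row (mutuality of a forward edge). [folklore] -/
def mutualN : IsoRow × Option IsoRow × Option IsoRow → Bool
  | (R, _, some R') => R'.twoIsoMate R
  | _ => false

/-- The row has a mate in the other list `ft`. [folklore] -/
def mateE (ft : List IsoRow) (t : IsoRow × Option IsoRow × Option IsoRow) : Bool := ft.any (fun R' => t.1.twoIsoMate R')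

/-- The decorated rows NOT mated to a list neighbour (for the 966: the `60` satellites of the 20 full-`2`-torsion curves). [folklore] -/
def loose (rows : List IsoRow) : List (IsoRow × Option IsoRow × Option IsoRow) := (withNbrs rows).filter (fun t => !(mateN t || mateP t))

/-- Soundness of the decoration: components of a triple are rows of the list (or the seed `p`). [folklore] -/
theorem mem_withNbrsAux {U : List IsoRow} : ∀ (p : Option IsoRow) (rows : List IsoRow), (∀ R', p = some R' → R' ∈ U) → rows ⊆ U →
    ∀ t ∈ withNbrsAux p rows, t.1 ∈ rows ∧ (∀ R', t.2.1 = some R' → R' ∈ U) ∧ (∀ R', t.2.2 = some R' → R' ∈ U)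
  | p, [], _, _, t, ht => by simp [withNbrsAux] at ht
  | p, R :: rest, hp, hsub, t, ht => by
    simp only [withNbrsAux, List.mem_cons] at ht
    rcases ht with rfl | ht
    · refine ⟨List.mem_cons_self, hp, fun R' h => ?_⟩
      simp only at h
      exact hsub (List.mem_cons_of_mem _ (List.mem_of_mem_head? (Option.mem_def.mpr h)))
    · have ih := mem_withNbrsAux (some R) rest (fun R' h => by cases h; exact hsub List.mem_cons_self)
        (fun x hx => hsub (List.mem_cons_of_mem _ hx)) t ht
      exact ⟨List.mem_cons_of_mem _ ih.1, ih.2⟩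

/-- Completeness of the decoration: every row occurs as the first component of a triple. [folklore] -/
theorem exists_withNbrsAux : ∀ (p : Option IsoRow) (rows : List IsoRow), ∀ R ∈ rows, ∃ t ∈ withNbrsAux p rows, t.1 = R
  | p, [], R, hR => by simp at hR
  | p, R₀ :: rest, R, hR => by
    rcases List.mem_cons.mp hR with rfl | hR
    · exact ⟨(R, p, rest.head?), by simp [withNbrsAux], rfl⟩
    · obtain ⟨t, ht, h⟩ := exists_withNbrsAux (some R₀) rest R hR
      exact ⟨t, by simp only [withNbrsAux, List.mem_cons]; exact Or.inr ht, h⟩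

/-- A triple of `withNbrs rows`: its row and its neighbours are rows of `rows`. [folklore] -/
theorem mem_withNbrs {rows : List IsoRow} {t : IsoRow × Option IsoRow × Option IsoRow} (ht : t ∈ withNbrs rows) :
    t.1 ∈ rows ∧ (∀ R', t.2.1 = some R' → R' ∈ rows) ∧ (∀ R', t.2.2 = some R' → R' ∈ rows) :=
  mem_withNbrsAux none rows (fun _ h => by cases h) (fun _ h => h) t ht

/-- Soundness of the three mate tests on a triple of `withNbrs rows`. [folklore] -/
theorem exists_mate_of_tests {rows ft : List IsoRow} {t : IsoRow × Option IsoRow × Option IsoRow} (ht : t ∈ withNbrs rows)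
    (h : (mateN t || mateP t || mateE ft t) = true) : ∃ R' ∈ rows ++ ft, t.1.twoIsoMate R' = true := by
  obtain ⟨-, hp, hn⟩ := mem_withNbrs ht
  obtain ⟨R, p, n⟩ := t
  simp only [Bool.or_eq_true] at h
  rcases h with (h | h) | h
  · cases n with
    | none => simp [mateN] at h
    | some R' => exact ⟨R', List.mem_append_left _ (hn R' rfl), h⟩
  · cases p with
    | none => simp [mateP] at h
    | some R' => exact ⟨R', List.mem_append_left _ (hp R' rfl), h⟩
  · obtain ⟨R', hR', hm⟩ := List.any_eq_true.mp h
    exact ⟨R', List.mem_append_right _ hR', hm⟩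

/-- **From ONE linear kernel walk over the decorated rows to an isogenous mate for every row.** [folklore] -/
theorem forall_exists_mate {rows ft : List IsoRow} (hrows : rows.all IsoRow.check3 = true) (hft : ft.all IsoRow.check3 = true)
    (h : (withNbrs rows).all (fun t => mateN t || mateP t || mateE ft t) = true) :
    ∀ R ∈ rows, ∃ R' ∈ rows ++ ft, IsIsogenous R.curve R'.curve ∧ R'.curve ≠ R.curve ∧
      R'.s₁.D.toFinset = R.s₂.D.toFinset ∧ R'.s₂.D.toFinset = R.s₁.D.toFinset := by
  intro R hR
  obtain ⟨t, ht, rfl⟩ := exists_withNbrsAux none rows R hR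
  obtain ⟨R', hR', hm⟩ := exists_mate_of_tests ht (List.all_eq_true.mp h t ht)
  have hall : (rows ++ ft).all IsoRow.check3 = true := by rw [List.all_append, hrows, hft]; rfl
  exact ⟨R', hR', IsoRow.isIsogenous_of_twoIsoMate t.1 R' (List.all_eq_true.mp hrows t.1 hR) (List.all_eq_true.mp hall R' hR') hm⟩

/-- The full-`2`-torsion side: mates sought among the `loose` decorated rows of `iso` only (`60 × ≤ 60` tests). [folklore] -/
theorem forall_exists_mate_loose {ft iso : List IsoRow} (hft : ft.all IsoRow.check3 = true) (hiso : iso.all IsoRow.check3 = true)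
    (h : ft.all (fun R => (loose iso).any (fun t => R.twoIsoMate t.1)) = true) :
    ∀ R ∈ ft, ∃ R' ∈ iso, IsIsogenous R.curve R'.curve ∧ R'.curve ≠ R.curve ∧
      R'.s₁.D.toFinset = R.s₂.D.toFinset ∧ R'.s₂.D.toFinset = R.s₁.D.toFinset := by
  intro R hR
  obtain ⟨t, ht, hm⟩ := List.any_eq_true.mp (List.all_eq_true.mp h R hR)
  have ht1 : t.1 ∈ iso := (mem_withNbrs (List.mem_of_mem_filter ht)).1
  exact ⟨t.1, ht1, IsoRow.isIsogenous_of_twoIsoMate R t.1 (List.all_eq_true.mp hft R hR) (List.all_eq_true.mp hiso t.1 ht1) hm⟩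

end MateWalk

open MateWalk



/-! ### §3 The kernel walks (linear): every row has a mate; the split `453 + 453 + 60` -/

set_option maxHeartbeats 4000000 in
/-- KERNEL WALK 1 (one pass over the 966 decorated rows; mate tests against the two neighbours, and against the 60 only for the rest):
every KERNEL-ISO row is mated to the next row, to the previous row, or to a full-`2`-torsion row. [cite: CremonaAlgorithms1997, §3.6 and Table 1] -/
theorem rank3IsoRows_mateWalk :
    (withNbrs rank3IsoRows).all (fun t => mateN t || mateP t || mateE rank3FullTwoTorsionIsoRows t) = true := by
  decide +kernel

set_option maxHeartbeats 4000000 in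
/-- KERNEL WALK 2 (`60 × ≤ 60`): every full-`2`-torsion descent row `(E, Tᵢ)` is mated to one of the `loose` KERNEL-ISO rows (the census
curve `E/⟨Tᵢ⟩`). [cite: CremonaAlgorithms1997, §3.6 and Table 1] -/
theorem rank3FullTwoTorsionIsoRows_mateWalk :
    rank3FullTwoTorsionIsoRows.all (fun R => (loose rank3IsoRows).any (fun t => R.twoIsoMate t.1)) = true := by
  decide +kernel

set_option maxHeartbeats 4000000 in
/-- KERNEL WALK 3 (the split, one pass each): `453` of the 966 rows are mated to the NEXT row, `453` to the PREVIOUS row, none both,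
every forward edge is mutual (the next row's mate is this row — so the `453 + 453` rows form `453` disjoint EDGES), and exactly `60`
rows are loose (mated into the 20 full-`2`-torsion curves by WALK 1: `20` STARS `K_{1,3}`); `453 + 453 + 60 = 966`.
[cite: CremonaAlgorithms1997, §3.8 and Table 1] -/
theorem rank3IsoRows_mateSplit :
    (withNbrs rank3IsoRows).countP mateN = 453 ∧ (withNbrs rank3IsoRows).countP mateP = 453 ∧
    (withNbrs rank3IsoRows).countP (fun t => mateN t && mateP t) = 0 ∧
    (withNbrs rank3IsoRows).all (fun t => !mateN t || mutualN t) = true ∧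
    (loose rank3IsoRows).length = 60 := by
  refine ⟨?_, ?_, ?_, ?_, ?_⟩ <;> decide +kernel

/-- **THE `2`-ISOGENY GRAPH, iso side: every one of the 966 KERNEL-ISO census curves is `ℚ`-isogenous to ANOTHER of the 986 census
curves with a rational `2`-torsion point, and the two descents agree edge-wise (swapped Selmer lists).** Hypothesis-free.
[cite: SilvermanAEC2009, III.4 Example 4.5] [cite: CremonaAlgorithms1997, §3.6] -/
theorem rank3IsoRows_twoIsogenous : ∀ R ∈ rank3IsoRows, ∃ R' ∈ rank3IsoRows ++ rank3FullTwoTorsionIsoRows,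
    IsIsogenous R.curve R'.curve ∧ R'.curve ≠ R.curve ∧
      R'.s₁.D.toFinset = R.s₂.D.toFinset ∧ R'.s₂.D.toFinset = R.s₁.D.toFinset :=
  forall_exists_mate rank3IsoRows_check rank3FullTwoTorsionIsoRows_check rank3IsoRows_mateWalk

/-- **THE `2`-ISOGENY GRAPH, full-`2`-torsion side: for each of the 20 full-`2`-torsion census curves `E` and each rational `2`-torsion
point `Tᵢ`, the quotient `E/⟨Tᵢ⟩` is (`ℚ`-isomorphic to) one of the 966 KERNEL-ISO census curves, with swapped Selmer lists.**
Hypothesis-free. [cite: SilvermanAEC2009, III.4 Example 4.5] [cite: CremonaAlgorithms1997, §3.6] -/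
theorem rank3FullTwoTorsionIsoRows_twoIsogenous : ∀ R ∈ rank3FullTwoTorsionIsoRows, ∃ R' ∈ rank3IsoRows,
    IsIsogenous R.curve R'.curve ∧ R'.curve ≠ R.curve ∧
      R'.s₁.D.toFinset = R.s₂.D.toFinset ∧ R'.s₂.D.toFinset = R.s₁.D.toFinset :=
  forall_exists_mate_loose rank3FullTwoTorsionIsoRows_check rank3IsoRows_check rank3FullTwoTorsionIsoRows_mateWalk

/-! ### §4 Census-row forms: isogenous to ANOTHER rank-3 census curve -/

/-- A row of `rank3IsoRows ++ rank3FullTwoTorsionIsoRows` is the model of a census row of certified rank `3`.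
[cite: CremonaAlgorithms1997, Table 1] [cite: SilvermanTate2015, §3.6] -/
theorem exists_rank3Row_of_mem_append {R' : IsoRow} (h : R' ∈ rank3IsoRows ++ rank3FullTwoTorsionIsoRows) :
    ∃ r' ∈ rank3Table, r'.curve = R'.curve ∧ r'.curve.mordellWeilRank = 3 := by
  rcases List.mem_append.mp h with h | h
  · obtain ⟨r', hr', hc⟩ := rank3IsoRows_census R' h
    exact ⟨r', hr', hc, hc ▸ rank3IsoRows_rank R' h⟩
  · obtain ⟨r', hr', hc, ht⟩ := rank3FullTwoTorsionIsoRows_census R' h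
    exact ⟨r', ht, hc, mordellWeilRank_eq_three_of_mem_fullTwoTorsionRows r' hr'⟩

/-- **Census-row form (the 966)**: a row of `rank3Table` whose model occurs among the KERNEL-ISO rows is `ℚ`-isogenous to a DIFFERENT
curve of `rank3Table`, itself of kernel-certified rank `3`. Instantiate `h` by `decide`. [cite: SilvermanAEC2009, III.4 Example 4.5]
[cite: CremonaAlgorithms1997, §3.6, §3.8] -/
theorem Rank3Row.exists_isogenous_of_aKey_mem {r : Rank3Row} (h : aKey₃ r ∈ rank3IsoRows.map IsoRow.aKey) :
    ∃ r' ∈ rank3Table, IsIsogenous r.curve r'.curve ∧ r'.curve ≠ r.curve ∧ r'.curve.mordellWeilRank = 3 := by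
  obtain ⟨R, hR, hk⟩ := List.mem_map.mp h
  have hc : r.curve = R.curve := curve_eq_of_aKey_eq hk
  obtain ⟨R', hR', hiso, hne, -⟩ := rank3IsoRows_twoIsogenous R hR
  obtain ⟨r', hr', hc', hrk⟩ := exists_rank3Row_of_mem_append hR'
  exact ⟨r', hr', by rw [hc, hc']; exact hiso, by rw [hc, hc']; exact hne, hrk⟩

/-- **Census-row form (the 20)**: each of the 20 full-`2`-torsion census rows is `ℚ`-isogenous to a DIFFERENT curve of `rank3Table`
of kernel-certified rank `3` (one of its three quotients `E/⟨Tᵢ⟩`). [cite: SilvermanAEC2009, III.4 Example 4.5] [cite: CremonaAlgorithms1997, §3.6] -/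
theorem Rank3Row.exists_isogenous_of_mem_fullTwoTorsionRows {r : Rank3Row} (hr : r ∈ rank3FullTwoTorsionRows) :
    ∃ r' ∈ rank3Table, IsIsogenous r.curve r'.curve ∧ r'.curve ≠ r.curve ∧ r'.curve.mordellWeilRank = 3 := by
  obtain ⟨R, hR, hk⟩ := List.mem_map.mp (aKey₃_mem_isoKeys_of_mem_fullTwoTorsionRows hr)
  have hc : r.curve = R.curve := curve_eq_of_aKey_eq hk
  obtain ⟨R', hR', hiso, hne, -⟩ := rank3FullTwoTorsionIsoRows_twoIsogenous R hR
  obtain ⟨r', hr', hc'⟩ := rank3IsoRows_census R' hR'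
  exact ⟨r', hr', by rw [hc, hc']; exact hiso, by rw [hc, hc']; exact hne, hc' ▸ rank3IsoRows_rank R' hR'⟩

/-- **Summary: the `2`-isogeny graph of the 986.** (i) every one of the 966 KERNEL-ISO curves and (ii) every one of the 20 full-`2`-torsion
curves is `ℚ`-isogenous to another rank-3 census curve; (iii) the graph: `453 + 453` of the 966 are mated to their list neighbour (`453`
edges), `60` are loose and mated to a full-`2`-torsion curve by (i) (`20` stars `K_{1,3}`); `966` rows, `966 + 20 = 986`. Hypothesis-free.
[cite: CremonaAlgorithms1997, §3.6, §3.8, Table 1] [cite: SilvermanAEC2009, III.4 Example 4.5] -/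
theorem rank3_twoIsogenyGraph :
    (∀ r ∈ rank3Table, aKey₃ r ∈ rank3IsoRows.map IsoRow.aKey →
      ∃ r' ∈ rank3Table, IsIsogenous r.curve r'.curve ∧ r'.curve ≠ r.curve ∧ r'.curve.mordellWeilRank = 3) ∧
    (∀ r ∈ rank3FullTwoTorsionRows,
      ∃ r' ∈ rank3Table, IsIsogenous r.curve r'.curve ∧ r'.curve ≠ r.curve ∧ r'.curve.mordellWeilRank = 3) ∧
    (withNbrs rank3IsoRows).countP mateN = 453 ∧ (withNbrs rank3IsoRows).countP mateP = 453 ∧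
    (loose rank3IsoRows).length = 60 ∧
    rank3IsoRows.length = 966 ∧ rank3IsoRows.length + rank3FullTwoTorsionRows.length = 986 :=
  ⟨fun _ _ h => Rank3Row.exists_isogenous_of_aKey_mem h, fun _ hr => Rank3Row.exists_isogenous_of_mem_fullTwoTorsionRows hr,
    rank3IsoRows_mateSplit.1, rank3IsoRows_mateSplit.2.1, rank3IsoRows_mateSplit.2.2.2.2, rank3IsoRows_length,
    rank3_twoTorsion_doors_count⟩

end Summit.BirchSwinnertonDyer.BirchSwinnertonDyer.Rank2Observatory
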